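import Summits.Ventures.YMGap.Census.ZplusLowerBound
import HarnessLib

/-!
# Venture YMGap, track (b) census — `Z_Λ > 1` and `Z⁺_Λ > 1` as soon as one coefficient is positive (even torus, `d ≥ 3`)

HONEST FRAMING: venture file of the cell `pub-ymgap` (QuantumFields programme).  Exact statements about the finite torus `(ℤ/Lℤ)^d`,
`L` even, `d ≥ 3`; nothing about (5.15), confinement or any limit.

Tomboulis (arXiv:0707.2179 (2.14), (4.11): "equality holds only in the trivial case where all `c_j` vanish").  From the tree's quarter-exponent
chessboard bounds (`hypercubeLowerBoundExp_quarter`, `torusZplus_lowerBound_quarter`): if some `c_n > 0` (`1 ≤ n ≤ J`) then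
`Z_Λ({c_j}) > 1` and `Z⁺_Λ({c_j}; 𝒱_{ij}) > 1` — the non-triviality hypotheses of `InterpolationAlpha.exists_alpha_Ioc` /
`InterpolationAlphaPlus.exists_alphaPlus_Ioc`. [cite: Tomboulis2007Confinement, Prop. II.1 (ii) eq. (2.14); Prop. IV.2 (ii) eq. (4.11)]
-/

noncomputable section

open MeasureTheory Finset Real
open scoped BigOperators
open Literature.MathematicalPhysics.QuantumLattice
open Literature.MathematicalPhysics.QuantumFieldTheory
open Literature.MathematicalPhysics.QuantumFieldTheory.Tomboulis2007

namespace Summit.Ventures.YMGap.Census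

variable {d L : ℕ} [NeZero L]

omit [NeZero L] in
/-- The base of (2.13) exceeds `1` as soon as one coefficient in range is positive. -/
theorem one_lt_hypercubeBase {J : ℕ} {c : ℕ → ℝ} (hc : ∀ n, 1 ≤ n → 0 ≤ c n) {n₀ : ℕ} (hn₀ : n₀ ∈ Icc 1 J) (hpos : 0 < c n₀) :
    (1 : ℝ) < 1 + ∑ n ∈ Icc 1 J, ((n : ℝ) + 1) ^ 2 * c n ^ 6 := by
  have hle : ((n₀ : ℝ) + 1) ^ 2 * c n₀ ^ 6 ≤ ∑ n ∈ Icc 1 J, ((n : ℝ) + 1) ^ 2 * c n ^ 6 :=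
    Finset.single_le_sum (f := fun n : ℕ => ((n : ℝ) + 1) ^ 2 * c n ^ 6)
      (fun n hn => mul_nonneg (by positivity) (pow_nonneg (hc n (Finset.mem_Icc.1 hn).1) 6)) hn₀
  have hpos' : 0 < ((n₀ : ℝ) + 1) ^ 2 * c n₀ ^ 6 := by positivity
  linarith

/-- On an even torus with `d ≥ 2` the quarter exponent is at least `1`: `1 ≤ L^d / 4`. -/
theorem one_le_pow_div_four (hd : 2 ≤ d) (hL : Even L) : 1 ≤ L ^ d / 4 := by
  have hL0 : L ≠ 0 := NeZero.ne L
  obtain ⟨k, hk⟩ := hL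
  have hk1 : 1 ≤ k := by omega
  have h4 : 4 ≤ L ^ 2 := by rw [hk]; nlinarith
  have hpow : L ^ 2 ≤ L ^ d := Nat.pow_le_pow_right (Nat.pos_of_ne_zero hL0) hd
  exact (Nat.le_div_iff_mul_le (by norm_num)).2 (by omega)

/-- **`Z_Λ({c_j}) > 1` if some `c_j > 0`** (even torus, `d ≥ 3`, admissible `c`). [cite: Tomboulis2007Confinement, Prop. II.1 (ii) eq. (2.14)] -/
theorem one_lt_torusZ_of_pos (hd : 3 ≤ d) (hL : Even L) (J : ℕ) {c : ℕ → ℝ} (hc : CoeffAdmissible c) {n₀ : ℕ} (hn₀ : n₀ ∈ Icc 1 J)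
    (hpos : 0 < c n₀) : 1 < torusZ d L J c := by
  have hc' : ∀ n, 1 ≤ n → 0 ≤ c n := fun n hn => (hc n hn).1
  have hbase := one_lt_hypercubeBase hc' hn₀ hpos
  refine lt_of_lt_of_le ?_ (hypercubeLowerBoundExp_quarter hd hL J c hc)
  exact one_lt_pow₀ hbase (Nat.one_le_iff_ne_zero.1 (one_le_pow_div_four (by omega) hL))

/-- **`Z⁺_Λ({c_j}; 𝒱_{ij}) > 1` if some `c_j > 0`** (even torus, `d ≥ 3`, admissible `c`, any plane).
[cite: Tomboulis2007Confinement, Prop. IV.2 (ii) eq. (4.11)] -/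
theorem one_lt_torusZplus_of_pos (hd : 3 ≤ d) (hL : Even L) (J : ℕ) {i j : Fin d} (hij : i < j) {c : ℕ → ℝ} (hc : CoeffAdmissible c)
    {n₀ : ℕ} (hn₀ : n₀ ∈ Icc 1 J) (hpos : 0 < c n₀) : 1 < torusZplus d L J c (vortexSheet L i j hij) := by
  have hc' : ∀ n, 1 ≤ n → 0 ≤ c n := fun n hn => (hc n hn).1
  have hbase := one_lt_hypercubeBase hc' hn₀ hpos
  refine lt_of_lt_of_le ?_ (torusZplus_lowerBound_quarter hd hL J hij hc)
  exact one_lt_pow₀ hbase (Nat.one_le_iff_ne_zero.1 (one_le_pow_div_four (by omega) hL))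

end Summit.Ventures.YMGap.Census

end
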